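import Literature.Combinatorics.SetFamily.SpreadLemmaProofs
import HarnessLib

/-!
# The robust sunflower theorem (Alweiss–Lovett–Wu–Zhang; Rao; in the form of CKR Thm. 1.3)

A family `𝓕` of subsets of a finite set is a **`(p, ε)`-robust sunflower** (Rossman 2014;
[cite: CavalarKumarRossman2022, §1.1]) if, for a `p`-random subset `W` of the ground set,
`Pr[∃ F ∈ 𝓕, F ⊆ W ∪ Y] > 1 − ε`, where `Y = ⋂ 𝓕` is the core.

**Theorem** ([cite: CavalarKumarRossman2022, Thm. 1.3], after [cite: AlweissLovettWuZhang2021],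
[cite: Rao2020], Tao, Bell–Chueluecha–Warnke; explicit proof in [cite: CavalarKumarRossman2022,
Appendix (§6)]): "There exists a constant `B > 0` such that the following holds for all
`p, ε ∈ (0, 1/2]`. Let `𝓕` be an `ℓ`-uniform family such that `|𝓕| ≥ (B log(ℓ/ε)/p)^ℓ`. Then `𝓕`
contains a `(p, ε)`-robust sunflower."

This file PROVES it (`robust_sunflower_spreadConst`, `robust_sunflower`) with the explicit
constant `B = spreadConst = 2000` of the tree's spread lemma
(`Literature.Combinatorics.SetFamily.spread_lemma_spreadConst`, Bell 2023 form), by the one-step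
version of the CKR appendix argument already used for CKR Lemma 2.11 in
`Literature.Computability.Complexity.CKR.card_minimals_filter_card_eq_le`: a maximiser `T₀` of
`|𝓕_T|·r^{|T|}` over `|T| ≤ ℓ`, `r = B log(ℓ/ε)/p`, can be taken with `|T₀| < ℓ` because
`|𝓕| ≥ r^ℓ`; the link `{F ∖ T₀ : T₀ ⊆ F ∈ 𝓕}` is `r`-spread by maximality, so the spread lemma
makes a `p`-random set contain one of its members with probability `> 1 − ε`, i.e. the sub-family
`𝓕' = {F ∈ 𝓕 : T₀ ⊆ F}` (whose core contains `T₀`) is a `(p, ε)`-robust sunflower; moreover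
`|𝓕'| ≥ r^{ℓ − |T₀|} ≥ 2`, so the sunflower found is a genuine one (at least two sets), which
is the content used by plucking arguments ([cite: CavalarKumarRossman2022, §2],
Cavalar–Göös–Riazanov–Sofronova–Sokolov 2025, Lemma 1).

* `core 𝓕`, `IsRobustSunflower p ε 𝓕` — the definitions;
* `robust_sunflower_spreadConst` — the theorem with `B = 2000` and the bound `2 ≤ |𝓕'|`;
* `robust_sunflower` — the printed `∃ B > 0` form.

## References

* B. P. Cavalar, M. Kumar, B. Rossman, *Monotone circuit lower bounds from robust sunflowers*,
  Algorithmica 84 (2022) 3655–3685, Thm. 1.3, §1.1, Appendix [CavalarKumarRossman2022].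
* R. Alweiss, S. Lovett, K. Wu, J. Zhang, *Improved bounds for the sunflower lemma*, Ann. of
  Math. 194 (2021) [AlweissLovettWuZhang2021].
* A. Rao, *Coding for sunflowers*, Discrete Analysis 2020:2 [Rao2020].
* T. Bell, *The Park–Pham theorem with optimal convergence rate*, Electron. J. Combin. 30(2)
  (2023), Thm. 3 and Lemma 10 [Bell2023].
-/

namespace Literature.Combinatorics.SetFamily

open Finset

variable {α : Type*} [Fintype α] [DecidableEq α]

/-! ### Robust sunflowers -/

/-- The **core** `Y = ⋂ 𝓕` of a family of sets (the whole ground set for the empty family).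
[cite: CavalarKumarRossman2022, §1.1] -/
def core (F : Finset (Finset α)) : Finset α :=
  univ.filter fun x => ∀ S ∈ F, x ∈ S

/-- Membership in the core. [cite: CavalarKumarRossman2022, §1.1] -/
@[simp] theorem mem_core {F : Finset (Finset α)} {x : α} : x ∈ core F ↔ ∀ S ∈ F, x ∈ S := by
  simp [core]

/-- The core is contained in every member. [cite: CavalarKumarRossman2022, §1.1] -/
theorem core_subset {F : Finset (Finset α)} {S : Finset α} (hS : S ∈ F) : core F ⊆ S :=
  fun _ hx => mem_core.1 hx S hS

/-- A common subset of all members lies in the core. [cite: CavalarKumarRossman2022, §1.1] -/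
theorem subset_core {F : Finset (Finset α)} {T : Finset α} (hT : ∀ S ∈ F, T ⊆ S) :
    T ⊆ core F :=
  fun _ hx => mem_core.2 fun S hS => hT S hS hx

/-- A **`(p, ε)`-robust sunflower**: a family `𝓕` with
`Pr_{W ∼ μ_p}[∃ F ∈ 𝓕, F ⊆ W ∪ Y] > 1 − ε`, `Y = ⋂ 𝓕` its core, the probability written as the
`μ_p`-mass (`biasedWeight`) of the event. (Rossman's notion; every `ℓ`-uniform sunflower with `r`
petals is `(p, e^{−rp^ℓ})`-robust.) [cite: CavalarKumarRossman2022, §1.1 (display)] -/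
def IsRobustSunflower (p ε : ℝ) (F : Finset (Finset α)) : Prop :=
  1 - ε < ∑ W ∈ univ.filter (fun W : Finset α => ∃ S ∈ F, S ⊆ W ∪ core F), biasedWeight p W

/-- A robust sunflower with `ε ≤ 1` is a nonempty family (the event is impossible for the empty
family). [cite: CavalarKumarRossman2022, §1.1] -/
theorem IsRobustSunflower.nonempty {p ε : ℝ} {F : Finset (Finset α)} (hε : ε ≤ 1)
    (h : IsRobustSunflower p ε F) : F.Nonempty := by
  rw [nonempty_iff_ne_empty]
  rintro rfl
  have h0 : (univ.filter fun W : Finset α => ∃ S ∈ (∅ : Finset (Finset α)), S ⊆ W ∪ core ∅) = ∅ :=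
    filter_eq_empty_iff.2 fun W _ => by simp
  unfold IsRobustSunflower at h
  rw [h0, sum_empty] at h
  linarith

/-! ### The theorem -/

/-- **The robust sunflower theorem, explicit constant** ([cite: CavalarKumarRossman2022, Thm. 1.3]
with `B = spreadConst = 2000`): for `ℓ ≥ 1`, `p, ε ∈ (0, 1/2]` and an `ℓ`-uniform family `𝓕` of
subsets of a finite set with `|𝓕| ≥ (B log(ℓ/ε)/p)^ℓ`, some sub-family `𝓕' ⊆ 𝓕` with at least two
members is a `(p, ε)`-robust sunflower. (Proof: CKR Appendix, one-step form — maximise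
`|𝓕_T| r^{|T|}`, the link at a maximiser `T₀` with `|T₀| < ℓ` is `r`-spread, apply the spread
lemma, lift along `T₀ ⊆ core`.) [cite: CavalarKumarRossman2022, Thm. 1.3 and Appendix] [cite: Rao2020] [cite: AlweissLovettWuZhang2021] -/
theorem robust_sunflower_spreadConst (F : Finset (Finset α)) (ℓ : ℕ) (p ε : ℝ) (hℓ : 1 ≤ ℓ)
    (hp0 : 0 < p) (hp1 : p ≤ 1 / 2) (hε0 : 0 < ε) (hε1 : ε ≤ 1 / 2)
    (hunif : ∀ S ∈ F, #S = ℓ)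
    (hbig : (spreadConst * Real.log (ℓ / ε) / p) ^ ℓ ≤ (#F : ℝ)) :
    ∃ F' ⊆ F, 2 ≤ #F' ∧ IsRobustSunflower p ε F' := by
  set r : ℝ := spreadConst * Real.log (ℓ / ε) / p with hr
  have hLg : 1 / 2 ≤ Real.log (ℓ / ε) := (rounds_bound hℓ hε0 hε1).2.2
  have hr0 : 0 < r := by
    have := spreadConst_pos
    have : 0 < Real.log (ℓ / ε) := by linarith
    positivity
  have hr2 : 2 ≤ r := by
    rw [hr, le_div_iff₀ hp0, spreadConst]
    nlinarith
  -- the weight `g(T) = |F_T| r^{|T|}` and a maximiser `T₀` with `|T₀| < ℓ`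
  set g : Finset α → ℝ := fun T => #(F.filter fun S => T ⊆ S) * r ^ #T with hg
  have hg0 : g ∅ = #F := by
    have hfe : (F.filter fun S => (∅ : Finset α) ⊆ S) = F :=
      filter_true_of_mem fun S _ => empty_subset S
    simp only [hg, hfe, card_empty, pow_zero, mul_one]
  obtain ⟨T₁, hT₁, hmax₁⟩ := exists_max_image (univ.filter fun T : Finset α => #T ≤ ℓ) g
    ⟨∅, mem_filter.2 ⟨mem_univ _, by simp⟩⟩
  obtain ⟨T₀, hT₀ℓ, hT₀lt, hmax⟩ :
      ∃ T₀ : Finset α, #T₀ ≤ ℓ ∧ #T₀ < ℓ ∧ ∀ T : Finset α, #T ≤ ℓ → g T ≤ g T₀ := by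
    by_cases hlt : #T₁ < ℓ
    · exact ⟨T₁, (mem_filter.1 hT₁).2, hlt,
        fun T hT => hmax₁ T (mem_filter.2 ⟨mem_univ _, hT⟩)⟩
    · have hT₁ℓ : #T₁ = ℓ := le_antisymm (mem_filter.1 hT₁).2 (not_lt.1 hlt)
      refine ⟨∅, by simp, by simp; omega, fun T hT => ?_⟩
      have hsub : (F.filter fun S => T₁ ⊆ S) ⊆ {T₁} := by
        intro S hS
        obtain ⟨hSF, hTS⟩ := mem_filter.1 hS
        rw [mem_singleton]
        exact (eq_of_subset_of_card_le hTS (by rw [hunif S hSF, hT₁ℓ])).symm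
      have hm1 : (#(F.filter fun S => T₁ ⊆ S) : ℝ) ≤ 1 := by
        exact_mod_cast (card_le_card hsub).trans (card_singleton T₁).le
      calc g T ≤ g T₁ := hmax₁ T (mem_filter.2 ⟨mem_univ _, hT⟩)
        _ ≤ r ^ ℓ := by
            show (#(F.filter fun S => T₁ ⊆ S) : ℝ) * r ^ #T₁ ≤ r ^ ℓ
            rw [hT₁ℓ]
            exact mul_le_of_le_one_left (by positivity) hm1
        _ ≤ #F := hbig
        _ = g ∅ := hg0.symm
  have hgT₀ : (#F : ℝ) ≤ g T₀ := hg0 ▸ hmax ∅ (by simp)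
  set m : ℕ := #(F.filter fun S => T₀ ⊆ S) with hm
  have hgT₀' : g T₀ = m * r ^ #T₀ := rfl
  -- `m ≥ r ^ (ℓ - |T₀|) ≥ r ≥ 2`
  have hm_ge : r ^ (ℓ - #T₀) ≤ (m : ℝ) := by
    have h1 : r ^ ℓ ≤ (m : ℝ) * r ^ #T₀ := by rw [← hgT₀']; exact hbig.trans hgT₀
    have h2 : r ^ ℓ = r ^ (ℓ - #T₀) * r ^ #T₀ := by rw [← pow_add, Nat.sub_add_cancel hT₀ℓ]
    rw [h2] at h1
    exact le_of_mul_le_mul_right h1 (by positivity)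
  have hm2 : 2 ≤ m := by
    have : (2 : ℝ) ≤ m :=
      calc (2 : ℝ) ≤ r := hr2
        _ = r ^ 1 := (pow_one r).symm
        _ ≤ r ^ (ℓ - #T₀) := pow_le_pow_right₀ (by linarith) (by omega)
        _ ≤ m := hm_ge
    exact_mod_cast this
  have hmpos : 0 < m := by omega
  -- the link `G = {S \ T₀ : S ∈ F, T₀ ⊆ S}`
  set G : Finset (Finset α) := (F.filter fun S => T₀ ⊆ S).image fun S => S \ T₀ with hG
  have hGcard : #G = m := by
    rw [hG, card_image_of_injOn]
    intro S hS S' hS' h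
    have hTS : T₀ ⊆ S := (mem_filter.1 hS).2
    have hTS' : T₀ ⊆ S' := (mem_filter.1 hS').2
    change S \ T₀ = S' \ T₀ at h
    rw [← sdiff_union_of_subset hTS, ← sdiff_union_of_subset hTS', h]
  have hGne : G.Nonempty := by
    rw [← card_pos, hGcard]; exact hmpos
  have hGbdd : ∀ S' ∈ G, #S' ≤ ℓ := by
    intro S' hS'
    obtain ⟨S, hS, rfl⟩ := mem_image.1 hS'
    exact (card_le_card sdiff_subset).trans (hunif S (mem_filter.1 hS).1).le
  -- `G` is `r`-spread, by the maximality of `T₀`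
  have hGsp : IsSpread r G := by
    intro Z
    rw [hGcard]
    have hle : #(G.filter fun S' => Z ⊆ S') ≤ #(F.filter fun S => T₀ ∪ Z ⊆ S) := by
      have : (G.filter fun S' => Z ⊆ S') ⊆
          (F.filter fun S => T₀ ∪ Z ⊆ S).image fun S => S \ T₀ := by
        intro S' hS'
        obtain ⟨hS'G, hZS'⟩ := mem_filter.1 hS'
        obtain ⟨S, hS, rfl⟩ := mem_image.1 hS'G
        obtain ⟨hSF, hTS⟩ := mem_filter.1 hS
        exact mem_image.2 ⟨S, mem_filter.2 ⟨hSF, union_subset hTS (hZS'.trans sdiff_subset)⟩, rfl⟩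
      exact (card_le_card this).trans card_image_le
    by_cases hdisj : Disjoint T₀ Z
    · by_cases hsize : #(T₀ ∪ Z) ≤ ℓ
      · have hmx := hmax (T₀ ∪ Z) hsize
        simp only [hg] at hmx
        rw [card_union_of_disjoint hdisj, pow_add] at hmx
        have hrZ : 0 < r ^ #Z := by positivity
        have hrT : 0 < r ^ #T₀ := by positivity
        rw [le_div_iff₀ hrZ]
        calc (#(G.filter fun S' => Z ⊆ S') : ℝ) * r ^ #Z
            ≤ #(F.filter fun S => T₀ ∪ Z ⊆ S) * r ^ #Z := by
              exact mul_le_mul_of_nonneg_right (by exact_mod_cast hle) hrZ.le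
          _ ≤ m := by
              have : (#(F.filter fun S => T₀ ∪ Z ⊆ S) : ℝ) * r ^ #Z * r ^ #T₀ ≤ m * r ^ #T₀ := by
                calc (#(F.filter fun S => T₀ ∪ Z ⊆ S) : ℝ) * r ^ #Z * r ^ #T₀
                    = #(F.filter fun S => T₀ ∪ Z ⊆ S) * (r ^ #T₀ * r ^ #Z) := by ring
                  _ ≤ m * r ^ #T₀ := hmx
              exact le_of_mul_le_mul_right this hrT
      · have h0 : #(F.filter fun S => T₀ ∪ Z ⊆ S) = 0 := by
          rw [card_eq_zero, filter_eq_empty_iff]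
          intro S hS hsub
          have := card_le_card hsub
          rw [hunif S hS] at this
          exact hsize this
        rw [h0] at hle
        have : (#(G.filter fun S' => Z ⊆ S') : ℝ) = 0 := by exact_mod_cast Nat.le_zero.1 hle
        rw [this]
        positivity
    · have h0 : #(G.filter fun S' => Z ⊆ S') = 0 := by
        rw [card_eq_zero, filter_eq_empty_iff]
        intro S' hS' hZS'
        obtain ⟨S, -, rfl⟩ := mem_image.1 hS'
        apply hdisj
        rw [disjoint_iff_ne]
        rintro x hxT _ hxZ rfl
        exact (mem_sdiff.1 (hZS' hxZ)).2 hxT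
      rw [h0, Nat.cast_zero]
      positivity
  -- the spread lemma for the link
  have hhit := spread_lemma_spreadConst G ℓ p ε hℓ hp0 hp1 hε0 hε1 hGne hGbdd hGsp
  -- the sunflower `F' = {S ∈ F : T₀ ⊆ S}`
  refine ⟨F.filter fun S => T₀ ⊆ S, filter_subset _ _, hm2, ?_⟩
  have hT₀core : T₀ ⊆ core (F.filter fun S => T₀ ⊆ S) :=
    subset_core fun S hS => (mem_filter.1 hS).2
  unfold IsRobustSunflower
  refine hhit.trans_le (sum_le_sum_of_subset_of_nonneg ?_ ?_)
  · intro W hW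
    obtain ⟨S', hS'G, hS'W⟩ := (mem_filter.1 hW).2
    obtain ⟨S, hS, rfl⟩ := mem_image.1 hS'G
    refine mem_filter.2 ⟨mem_univ _, S, hS, fun x hx => ?_⟩
    by_cases hxT : x ∈ T₀
    · exact mem_union_right _ (hT₀core hxT)
    · exact mem_union_left _ (hS'W (mem_sdiff.2 ⟨hx, hxT⟩))
  · intro W _ _
    exact biasedWeight_nonneg hp0.le (by linarith) W

/-- **The robust sunflower theorem** in the printed form "there exists a constant `B > 0` such
that for all `p, ε ∈ (0, 1/2]`, every `ℓ`-uniform `𝓕` with `|𝓕| ≥ (B log(ℓ/ε)/p)^ℓ` contains a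
`(p, ε)`-robust sunflower" (here: one with at least two members; `ℓ ≥ 1`).
[cite: CavalarKumarRossman2022, Thm. 1.3] [cite: AlweissLovettWuZhang2021] [cite: Rao2020] -/
theorem robust_sunflower : ∃ B : ℝ, 0 < B ∧ ∀ {α : Type*} [Fintype α] [DecidableEq α]
    (F : Finset (Finset α)) (ℓ : ℕ) (p ε : ℝ), 1 ≤ ℓ → 0 < p → p ≤ 1 / 2 → 0 < ε → ε ≤ 1 / 2 →
    (∀ S ∈ F, #S = ℓ) → (B * Real.log (ℓ / ε) / p) ^ ℓ ≤ (#F : ℝ) →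
    ∃ F' ⊆ F, 2 ≤ #F' ∧ IsRobustSunflower p ε F' :=
  ⟨spreadConst, spreadConst_pos, fun F ℓ p ε => robust_sunflower_spreadConst F ℓ p ε⟩

end Literature.Combinatorics.SetFamily
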